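import Summits.BirchSwinnertonDyer.BirchSwinnertonDyer.Theorems.SignedLowerHalvesSmallImageLowerHalfBothSignsRttD2SeqGlueSocket
import Summits.BirchSwinnertonDyer.BirchSwinnertonDyer.Theorems.SignedLowerHalvesSmallImageLowerHalfBothSignsRttD2SeqPlaceData
import HarnessLib

/-!
# Route `SignedLowerHalves`, crux L `SmallImageLowerHalfBothSigns` (stmt-BirchSwinnertonDyer-23599), line `rtt_w3` v13 — E2:
# E2 FROM ITS TAILS — the candidate v14 composition BY NAME, in the stub's own binders

WIDTH seat `bsd-line-slh-p3-w3` g20 under LEAD `cruxlead-stmt-BirchSwinnertonDyer-23599` g10 (cell `bsd-ssimc`); BRIEF-E2 rev 3.1 §3 «v14 registry act when (1′)+(5′) pin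
`Q`/`gX`: `stub_charRoad_ns := ∀ shared, ∀ Dψ, (Col-tail ∧ K-tail ∧ an-tail)` with the glue as the by-name composition». Sequel of parts 1–6 (`…RttD2SeqLocalCondition`,
`…LocalDual`, `…LocalDualO`, `…GlueSocket`, `…JunctionSocket`, `…PlaceData`). THEOREMS ONLY (no definition, no named fact, no `sorry`); the research content of E2 is the
HYPOTHESIS `tails`; crux L, crux M, E2 and BSD remain OPEN and are proved for NO curve by any of this.
* ★★★ `charRoad_E2_of_tails`: data = the cyclotomic `κ` of `ℚ` restricted to the quadratic `K` (`p ≠ 2`, `p ∤ d_K`), the place `v = (p)`, the stub's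
  coefficients `M = GreenbergSelmer.Cofree θ (padicCoeffField S)` with a `Γ_{K_v}`-action pinned by `hres` (instance binder; filler `localAction`), `j`, `ε`, the
  stub's `Dψ` (f.g. torsion), `γ_K`, `[Algebra Λ Λ_𝒪]` with `halg`, the cusp-form data `g ι S₀`, `L ≠ 0`; hypothesis `tails` = for EVERY local generator `γ_v`,
  local dual datum `DQ` and pinned `Λ_𝒪`-structures `instX`/`instQ` (all of which EXIST in kernel: `exists_localGenerator_restrictOfFinrankEqTwo`,
  `nonempty_localCondDualData_cofree'`, `exists_moduleO_signedTransportDualDataSat`, `LocalCondDualData.exists_moduleO`): ∃ `z` with `gX z = 0` (row (2′)),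
  `Col` (row (5′)), `c ≠ 0`, `fv`, `hCol` (row (7′)) and `hK` (rows (6′)); conclusion = the E2-tail of `stub_charRoad_ns` for `Dψ.X` VERBATIM
  (via `charRoad_E2_of_locSat_cofree` = the LEAD's `charRoad_E2_of_localisation`, p776213).
References: [Kobayashi2003] Thm. 7.3 i), Thm. 1.3; [PollackRubin2004] §6–§7.
-/

set_option autoImplicit false
set_option linter.dupNamespace false -- D-0017: single-problem summit, the namespace repeats the problem name by design
noncomputable section

open scoped Classical
open NumberField IsDedekindDomain Field

universe u

namespace Summit.BirchSwinnertonDyer.BirchSwinnertonDyer.Theorems.SmallImageRttD2Seq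

open Literature.NumberTheory.EllipticCurves Literature.NumberTheory.EllipticCurves.Kobayashi2003
  Literature.NumberTheory.EllipticCurves.GreenbergVatsal2000 Literature.NumberTheory.GaloisRepresentations
  Summit.BirchSwinnertonDyer.BirchSwinnertonDyer.Theorems.SmallImageCharSignedSelmer

/-! ## §14. E2 FROM ITS TAILS, in the stub's own binders (candidate v14 composition BY NAME) -/

section E2OfTails

open scoped MatrixGroups ModularForm
open PowerSeries Literature.NumberTheory.IwasawaTheory CongruenceSubgroup Rat.HeightOneSpectrum Literature.NumberTheory.EllipticCurves.ModularForms
  Summit.BirchSwinnertonDyer.BirchSwinnertonDyer.Theorems.SmallImageRttCharRoad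

/-- ★★★ **E2 FROM ITS TAILS — the candidate v14 composition, in the stub's own binders.** Data: the cyclotomic `κ` of `ℚ` restricted to the quadratic `K`
(`p ≠ 2`, `p ∤ d_K`), the inert place `v = (p)`, the stub's coefficients `M = Cofree θ F` (`F = ℚ_p(S)`, `𝒪 = padicCoeffIntegers S`, `0 < [F:ℚ_p]`) with the
restricted `Γ_{K_v}`-action `localAction`, the stub's transport `j`, sign `ε`, dual datum `Dψ` (f.g. torsion over `Λ`), generator `γ_K`, the cusp form data
`g, ι, S₀` and `L ≠ 0`. HYPOTHESIS `tails` = the research content of E2 in Kobayashi's architecture, quantified over the auxiliary (essentially unique) choices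
made IN KERNEL by parts 1–6: for every local generator `γ_v`, every local dual datum `DQ`, all pinned `Λ_𝒪`-structures `instX`/`instQ`: ∃ `z ∈ DQ.X` with
`gX z = 0` (row (2′)), `Col : DQ.X ≃ₗ[Λ_𝒪] Λ_𝒪` (row (5′)), `c ≠ 0`, exponents `fv` and the explicit reciprocity law `hCol` (row (7′)), and
`hK : λ(ker gX ⧸ Λ_𝒪∙z) ≤ λ(Dψ.X ⧸ gX(Q))` (rows (6′)). CONCLUSION = the E2-tail of `stub_charRoad_ns` for `Dψ.X` VERBATIM. Proof: the choices EXIST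
(`exists_localGenerator_restrictOfFinrankEqTwo`, `nonempty_localCondDualData_stub`, `exists_moduleO_signedTransportDualDataSat` p776944,
`LocalCondDualData.exists_moduleO`), then `charRoad_E2_of_locSat_cofree` (= the LEAD's glue p776213 by name). Nothing here proves E2; crux L, crux M and BSD
remain open and are proved for NO curve. [cite: Kobayashi2003, Thm. 7.3 i), Thm. 1.3] [cite: PollackRubin2004, §6–§7, Theorem (p. 448)] -/
theorem charRoad_E2_of_tails {p : ℕ} [Fact p.Prime] (hp : p ≠ 2) {κ : ZpExtension ℚ p} (hκ : κ.IsCyclotomic)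
    {K : Type} [Field K] [NumberField K] (hK2 : Module.finrank ℚ K = 2) (hnd : ¬ (p : ℤ) ∣ NumberField.discr K)
    {v : HeightOneSpectrum (𝓞 K)} (hv : v.asIdeal = Ideal.span {((p : ℕ) : 𝓞 K)})
    (S : Set (PadicAlgCl p)) (hS : 0 < Module.finrank ℚ_[p] (padicCoeffField S)) [FiniteDimensional ℚ_[p] (padicCoeffField S)]
    [Algebra (IwasawaAlgebra p) (IwasawaAlgebraO S)]
    (halg : ∀ r : IwasawaAlgebra p, algebraMap (IwasawaAlgebra p) (IwasawaAlgebraO S) r = iwasawaToIwasawaO S r)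
    (θ : FramedGaloisRep K (padicCoeffIntegers S) 1)
    [DistribMulAction (absoluteGaloisGroup (v.adicCompletion K)) (GreenbergSelmer.Cofree θ (padicCoeffField S))]
    [SMulCommClass (absoluteGaloisGroup (v.adicCompletion K)) (padicCoeffIntegers S) (GreenbergSelmer.Cofree θ (padicCoeffField S))]
    (hres : ∀ (σ : absoluteGaloisGroup (v.adicCompletion K)) (m : GreenbergSelmer.Cofree θ (padicCoeffField S)),
      σ • m = resGalOfEmb (closureEmb (K := K) (v.adicCompletion K)) σ • m)
    (V : WeierstrassCurve K)
    (j : V.geomPrimaryTorsion p →+ GreenbergSelmer.Cofree θ (padicCoeffField S)) (S₀K : Set (HeightOneSpectrum (𝓞 K))) (ε : ℤˣ)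
    {γK : absoluteGaloisGroup K} (hγK : (κ.restrictOfFinrankEqTwo hp K hK2).IsTopGenerator γK)
    (D : SignedTransportDualDataSat (κ.restrictOfFinrankEqTwo hp K hK2) γK (GreenbergSelmer.Cofree θ (padicCoeffField S)) (padicCoeffIntegers S) V j S₀K ε)
    [Module.Finite (IwasawaAlgebra p) D.X] (hX : Module.IsTorsion (IwasawaAlgebra p) D.X)
    {N : ℕ} [NeZero N] (g : CuspForm (Gamma0 N) 2) (ι : coeffField g →+* PadicAlgCl p) (hng : IsNewform0 g)
    (S₀ : Finset (HeightOneSpectrum (𝓞 ℚ))) (L : IwasawaAlgebraO (Set.range ι)) (hL : L ≠ 0)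
    (tails : ∀ (γv : absoluteGaloisGroup (v.adicCompletion K))
        (hγv : (κ.restrictOfFinrankEqTwo hp K hK2).IsTopGenerator (resGalOfEmb (closureEmb (K := K) (v.adicCompletion K)) γv))
        (DQ : LocalCondDualData (κ.restrictOfFinrankEqTwo hp K hK2) (GreenbergSelmer.Cofree θ (padicCoeffField S)) (padicCoeffIntegers S) V j ε v γv)
        (instX : Module (IwasawaAlgebraO S) D.X) (instQ : Module (IwasawaAlgebraO S) DQ.X)
        (hιX : ∀ (f : IwasawaAlgebra p) (x : D.X), (letI := instX; iwasawaToIwasawaO S f • x) = f • x)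
        (hιQ : ∀ (f : IwasawaAlgebra p) (x : DQ.X), (letI := instQ; iwasawaToIwasawaO S f • x) = f • x)
        (hCX : ∀ (a : padicCoeffIntegers S) (x : D.X)
            (s : signedTransportSelmerInftySat (κ.restrictOfFinrankEqTwo hp K hK2) (GreenbergSelmer.Cofree θ (padicCoeffField S))
              (padicCoeffIntegers S) V j S₀K ε),
          D.toDual (letI := instX; (PowerSeries.C a : IwasawaAlgebraO S) • x) s =
            D.toDual x ⟨GreenbergSelmer.scalarH1 _ _ a s, scalarH1_mem_signedTransportSelmerInftySat _ _ (padicCoeffIntegers S) V j S₀K ε a s.2⟩)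
        (hCQ : ∀ (a : padicCoeffIntegers S) (x : DQ.X)
            (c : localCondInftySat (κ.restrictOfFinrankEqTwo hp K hK2) (GreenbergSelmer.Cofree θ (padicCoeffField S)) (padicCoeffIntegers S) V j ε v),
          DQ.toDual (letI := instQ; (PowerSeries.C a : IwasawaAlgebraO S) • x) c =
            DQ.toDual x (scalarLocalSat _ _ (padicCoeffIntegers S) V j ε v a c)),
        letI := instX; letI := instQ
        haveI : IsScalarTower (IwasawaAlgebra p) (IwasawaAlgebraO S) D.X := isScalarTower_iwasawaAlgebraO_of_smul_eq S halg hιX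
        haveI : IsScalarTower (IwasawaAlgebra p) (IwasawaAlgebraO S) DQ.X := isScalarTower_iwasawaAlgebraO_of_smul_eq S halg hιQ
        ∃ (z : DQ.X) (hz : gXHom D DQ hres (natCast_mem_asIdeal_of_eq_span hv) z = 0)
          (Col : DQ.X ≃ₗ[IwasawaAlgebraO S] IwasawaAlgebraO S) (c : PadicAlgCl p) (fv : HeightOneSpectrum (𝓞 ℚ) → ℤ_[p]),
          c ≠ 0 ∧ (∀ w ∈ S₀, fv w ≠ 0 ∧ (fv w).valuation = (frobeniusExponent p (natGenerator w : ℤ_[p])).valuation) ∧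
          iwasawaOToPowerSeries S (Col z) =
            PowerSeries.C c * iwasawaOToPowerSeries (Set.range ι) L *
              ∏ w ∈ S₀, Polynomial.aeval (PowerSeries.C ((natGenerator w : PadicAlgCl p)⁻¹) *
                  (PowerSeries.binomialSeries ℤ_[p] (fv w)).map (algebraMap ℤ_[p] (PadicAlgCl p)))
                (1 - Polynomial.C (embCoeff g ι (natGenerator w)) * Polynomial.X +
                  (if natGenerator w ∣ N then 0 else Polynomial.C (natGenerator w : PadicAlgCl p)) * Polynomial.X ^ 2) ∧
          let gX := gXLinearMapO S D DQ hres (natCast_mem_asIdeal_of_eq_span hv) instX instQ hιX hιQ hCX hCQ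
                (GreenbergSelmer.exists_pow_smul_cofree_eq_zero S θ) (GreenbergSelmer.isOpen_stabilizer_cofree S θ)
                (isOpen_stabilizer_of_hres (GreenbergSelmer.Cofree θ (padicCoeffField S)) v hres
                  (GreenbergSelmer.isOpen_stabilizer_cofree S θ)) hγK
                (isNonsplitIn_restrictOfFinrankEqTwo hp hκ K hK2 hnd (natCast_mem_asIdeal_of_eq_span hv)) hγv;
          lambdaInvariant p (LinearMap.ker gX ⧸ Submodule.span (IwasawaAlgebraO S) {(⟨z, hz⟩ : LinearMap.ker gX)}) ≤
            lambdaInvariant p (D.X ⧸ LinearMap.range gX)) :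
    ∃ d : ℕ, (∀ k : ℕ, ‖PowerSeries.coeff k (iwasawaOToPowerSeries (Set.range ι) L)‖ ≤
        ‖PowerSeries.coeff d (iwasawaOToPowerSeries (Set.range ι) L)‖) ∧
      (∀ k : ℕ, k < d → ‖PowerSeries.coeff k (iwasawaOToPowerSeries (Set.range ι) L)‖ <
        ‖PowerSeries.coeff d (iwasawaOToPowerSeries (Set.range ι) L)‖) ∧
      Module.finrank ℚ_[p] (padicCoeffField S) * (d + ∑ w ∈ S₀, p ^ (frobeniusExponent p (natGenerator w : ℤ_[p])).valuation *
        layerLambda ((1 - Polynomial.C (embCoeff g ι (natGenerator w)) * Polynomial.X +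
          (if natGenerator w ∣ N then 0 else Polynomial.C (natGenerator w : PadicAlgCl p)) * Polynomial.X ^ 2).comp
            (Polynomial.C ((natGenerator w : PadicAlgCl p)⁻¹) * (Polynomial.X + 1)))) ≤ lambdaInvariant p D.X := by
  have hvp := natCast_mem_asIdeal_of_eq_span hv
  have hnon := isNonsplitIn_restrictOfFinrankEqTwo hp hκ K hK2 hnd hvp
  have htor := GreenbergSelmer.exists_pow_smul_cofree_eq_zero S θ
  have hstabK := GreenbergSelmer.isOpen_stabilizer_cofree S θ
  have hstab := isOpen_stabilizer_of_hres (GreenbergSelmer.Cofree θ (padicCoeffField S)) v hres hstabK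
  -- the auxiliary choices exist
  obtain ⟨γv, hγv⟩ := exists_localGenerator_restrictOfFinrankEqTwo hp hκ K hK2 hnd hvp
  obtain ⟨DQ⟩ := nonempty_localCondDualData_cofree' (V := V) (j := j) (ε := ε) hres hnon hγv
  obtain ⟨instX, hιX, hCX⟩ := exists_moduleO_signedTransportDualDataSat D htor hstabK hγK
  obtain ⟨instQ, hιQ, hCQ⟩ := DQ.exists_moduleO htor hstab hnon hγv
  -- the research inputs for these choices
  obtain ⟨z, hz, Col, c, fv, hc, hfv, hCol, hK⟩ := tails γv hγv DQ instX instQ hιX hιQ hCX hCQ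
  exact charRoad_E2_of_locSat_cofree hres hS halg g ι hng S₀ D hX hγK hvp hnon hγv DQ instX instQ hιX hιQ hCX hCQ z hz hK Col L hL hc
    fv hfv hCol

end E2OfTails

end Summit.BirchSwinnertonDyer.BirchSwinnertonDyer.Theorems.SmallImageRttD2Seq

end
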